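import Summits.HubbardSuperconductivity.HubbardSuperconductivity.Theorems.AnisotropyChordTransferFibre3FinMHoleL12a
import Summits.HubbardSuperconductivity.HubbardSuperconductivity.Theorems.AnisotropyChordTransferFibre3FinMHoleL12b
import Summits.HubbardSuperconductivity.HubbardSuperconductivity.Theorems.AnisotropyChordTransferFibre3FinMHoleL12c
import Summits.HubbardSuperconductivity.HubbardSuperconductivity.Theorems.AnisotropyChordTransferFibre3FinMHoleL12d
import Summits.HubbardSuperconductivity.HubbardSuperconductivity.Theorems.AnisotropyChordTransferFibre3FinMHoleL12e

/-!
# Route `AnisotropyChord` / H0 rotor rung: ★ the regime clause `mHole ≥ 0` at `L = 12` for EVERY ground profile (FIN-class, kernel-certified)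

`mHole_nonneg_twelve`: for every `0 < Δ < 1` and every ground two-magnon profile `f` at `L = 12`, `0 ≤ mHole 12 Δ f`, i.e.
`T⁺ ≤ ε₁(1 − 5/V + 6/V²)/2` — the first half of the regime clause of the GM₃ assembly `gm3_allL` at this `L`, by the FIN
evaluator in convolution form (`…FinConvCell`, soundness `…FinMHoleConv.mHole_nonneg_of_cells3`, kernel facts `…FinMHoleL12*`).
Prover seat `hubbard-h0-rotor-p3` g4; helper for stmt-HubbardSuperconductivity-23918 (piece A of rung 19089; `--supports`, helper class).
WHAT THIS IS NOT: nothing here proves superconductivity in the Hubbard model (rotor TARGET as worded stays FALSE, g15 verdict); one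
hypothesis of ONE conditional reduction at one `L`; the three β-free cruxes and the side condition remain. Tree imports only; no sorry.
-/

set_option linter.dupNamespace false
set_option autoImplicit false

namespace Summit.HubbardSuperconductivity.HubbardSuperconductivity.Theorems.AnisotropyChord.Transfer.Fibre3

namespace FinCell

/-- the cell list at `L = 12` (14 points in units of `2^60`, from `0` to `≥ lamTop 12`) passes cellwise. [folklore] -/
theorem cellsAll_twelve : cellsAll (mholeCellOK3 12) [0, 775976497637677, 2017538893857961, 4004038727810415, 7182438462134342, 9725158249593484, 11759334079560798, 15014015407508500, 17617760469866662, 18659258494809928, 20325655334719152, 22991890278573912, 27257866188741528, 31039059905507096] = true := by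
  simp only [cellsAll, cell12_1, cell12_2, cell12_3, cell12_4, cell12_5, cell12_6, cell12_7, cell12_8, cell12_9, cell12_10, cell12_11, cell12_12, cell12_13, Bool.true_and]

/-- kernel fact: the cell list at `L = 12` is a certificate (`mholeCheck3`): head `0`, length, `lamTop 12 ≤` last point, all cells. [folklore] -/
theorem mholeCheck3_twelve : mholeCheck3 12 [0, 775976497637677, 2017538893857961, 4004038727810415, 7182438462134342, 9725158249593484, 11759334079560798, 15014015407508500, 17617760469866662, 18659258494809928, 20325655334719152, 22991890278573912, 27257866188741528, 31039059905507096] = true := by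
  unfold mholeCheck3
  rw [cellsAll_twelve]
  decide +kernel

end FinCell

/-- ★★ THE REGIME CLAUSE `mHole ≥ 0` AT `L = 12`: every ground two-magnon profile at `L = 12`, `0 < Δ < 1`, has
`T⁺ ≤ ε₁(1 − 5/V + 6/V²)/2` (FIN-class, kernel-certified with zero data). [folklore] -/
theorem mHole_nonneg_twelve {Δ : ℝ} (hΔ0 : 0 < Δ) (hΔ1 : Δ < 1) :
    ∀ lam2 : ℝ, ∀ f : Tor 12 → ℝ, IsGroundTwoMagnon 12 Δ lam2 f → 0 ≤ mHole 12 Δ f :=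
  FinCell.mHole_nonneg_of_cells3 12 (by norm_num) [0, 775976497637677, 2017538893857961, 4004038727810415, 7182438462134342, 9725158249593484, 11759334079560798, 15014015407508500, 17617760469866662, 18659258494809928, 20325655334719152, 22991890278573912, 27257866188741528, 31039059905507096] FinCell.mholeCheck3_twelve hΔ0 hΔ1

end Summit.HubbardSuperconductivity.HubbardSuperconductivity.Theorems.AnisotropyChord.Transfer.Fibre3
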